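import Literature.Dynamics.SymbolicDynamics.StrongIrreducibility
import Mathlib.Analysis.Asymptotics.Defs
import Mathlib.Analysis.SpecialFunctions.Log.Basic
import HarnessLib

/-!
# Periodic points of strongly irreducible / block gluing `ℤ²`- and `ℤ^d`-subshifts: named facts

The published theorems on (non-)existence and density of periodic points under gluing hypotheses,
vendored as NAMED FACTS (`def … : Prop`, D-0014: used as explicit hypotheses `(h : Fact)`,
discharged by a later `theorem Fact_holds : Fact`) on top of the vocabulary of
`Literature/Dynamics/SymbolicDynamics/StrongIrreducibility.lean` (`IsSFT`, `IsStronglyIrreducible`,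
`IsBlockGluing`, `IsLinearlyBlockGluing`, `IsAperiodic`, `HasFiniteOrbit`, `IsSubshift`). They are
the hypotheses named by route PneNP/AperiodicTorus (items GluingSubshiftWidth and crux #5).

* `Lightwood2003_densePeriodic` — strongly irreducible `ℤ²`-SFTs have dense periodic points
  (Lightwood 2003; the primary source is paywalled here (acq-02269) and the statement is formalized
  from its restatement in Ceccherini-Silberstein–Coornaert 2012, §1: "Lightwood also proved that
  any strongly irreducible subshift of finite type over `ℤ²` contains a dense set of periodic
  configurations", with THEIR definitions: SFT in window form, periodic = finite orbit, strongly
  irreducible = `Δ`-irreducible for some finite window `Δ`, which on `ℤ²` is SI with some gap `g`).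
* `GangloffSablik2021_densePeriodic` — Gangloff–Sablik Prop. 23: an `f`-block gluing `ℤ²`-SFT
  with `f ∈ o(log n)` and `f ≤ id` has a dense set of periodic points.
* `GangloffSablik2021_aperiodic` — Gangloff–Sablik Thm. 26 (= the "Theorem (aperiodicity)" of
  their introduction): there exists a linearly block gluing aperiodic `ℤ²`-SFT.
* `Hochman2025_existsSIAperiodic` — Hochman Thm. 1.1: for every `d ≥ 2` there exist strongly
  irreducible `ℤ^d` subshifts without periodic points.

## Design notes (faithfulness)

* Alphabets. Universal statements quantify over an arbitrary finite discrete alphabet `A : Type`;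
  existence statements produce an alphabet `Fin k` (any finite alphabet is a relabelling of some
  `Fin k`, and all notions are invariant under relabelling). Hochman's example has "a very large
  alphabet" and gap `10` for `d = 2` (§1.1, not part of Thm. 1.1 and not encoded).
* Non-emptiness is explicit in the two existence facts (the empty set is vacuously an aperiodic,
  block gluing, strongly irreducible SFT); both sources construct non-empty systems (Gangloff–Sablik
  build on Robinson's subshift, non-empty by their Thm. 5; Hochman Cor. 5.9 "X is a non-empty
  subshift").
* Gangloff–Sablik §4.1.1 assume the gap function non-decreasing throughout; this standing
  hypothesis is kept (`Monotone f`) in the universal fact `GangloffSablik2021_densePeriodic` and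
  dropped (harmlessly: it only weakens an existence claim) from `GangloffSablik2021_aperiodic`.
  `f ∈ o(log n)` is Mathlib's `(fun n => (f n : ℝ)) =o[atTop] fun n => Real.log n`; the base of the
  logarithm is immaterial for `o(·)`.
* "Dense set of periodic points" of `X` (subspace topology) is `X ⊆ closure {x ∈ X | periodic}`;
  Gangloff–Sablik's "(doubly) periodic" and Hochman's / Ceccherini-Silberstein–Coornaert's "finite
  orbit" agree on `ℤ²` (`hasFiniteOrbit_iff_exists_shift_eq`).
* Hochman §1.1 does not name the norm behind the gap; Thm. 1.1 asserts strong irreducibility for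
  SOME gap, which is norm-independent, and we state it with Mathlib's sup-metric on `Fin d → ℤ`
  (see the design notes of `StrongIrreducibility.lean`).
* Numbering for Gangloff–Sablik follows arXiv:1706.01627 (Def. 14 = `f`-block gluing in §4.1.1,
  Prop. 23 in §5.2, Thm. 26 in §5.4); the published version (J. Anal. Math. 144 (2021) 21–118,
  acq-02273) may number differently — the section titles are quoted in each docstring.

## References

* [Lightwood2003] S. J. Lightwood, *Morphisms from non-periodic `ℤ²` subshifts I: constructing
  embeddings from homomorphisms*, Ergodic Theory Dynam. Systems 23 (2003) 587–609.
* [CeccheriniSilbersteinCoornaert2012] T. Ceccherini-Silberstein, M. Coornaert, *On the density of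
  periodic configurations in strongly irreducible subshifts*, Nonlinearity 25 (2012) 2119–2131, §1
  (p. 2 of arXiv:1110.4921: restatement of Lightwood's `ℤ²` theorem; the `ℤ^d`, `d ≥ 3` case is
  recorded there as open). Read via `lit read arxiv:1110.4921`.
* [GangloffSablik2021] S. Gangloff, M. Sablik, *Quantified block gluing for multidimensional
  subshifts of finite type: aperiodicity and entropy*, J. Anal. Math. 144 (2021) 21–118; §5.2
  Prop. 23, §5.4 Thm. 26 (arXiv:1706.01627 numbering). Read via `lit read arxiv:1706.01627`.
* [Hochman2025] M. Hochman, *Irreducibility and periodicity in `ℤ²` symbolic systems*, Discrete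
  Analysis 2025:17, Thm. 1.1 (p. 2). Read via `lit read arxiv:2401.02273`.
-/

open Set Filter Asymptotics
open _root_.SymbolicDynamics.FullShift

namespace Literature.Dynamics.SymbolicDynamics

/-- **Lightwood (2003): strongly irreducible `ℤ²` shifts of finite type have dense periodic
points.** For a finite (discrete) alphabet `A` and `X ⊆ A^{ℤ²}` a subshift of finite type
(`IsSFT`, window form) that is strongly irreducible with some gap `g` (`IsStronglyIrreducible X g`,
sup-metric), the periodic configurations of `X` (finite orbit under the shift action,
`HasFiniteOrbit`) are dense in `X`: `X ⊆ closure {x ∈ X | HasFiniteOrbit x}`.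
Formalized from the restatement in Ceccherini-Silberstein–Coornaert 2012, §1 ("Lightwood also
proved that any strongly irreducible subshift of finite type over `ℤ²` contains a dense set of
periodic configurations"); the question for `ℤ^d`, `d ≥ 3`, is recorded there as open.
[cite: Lightwood2003, main theorem on periodic points; restated in CeccheriniSilbersteinCoornaert2012 §1] -/
def Lightwood2003_densePeriodic : Prop :=
  ∀ (A : Type) [Fintype A] [TopologicalSpace A] [DiscreteTopology A] (X : Set (ℤ × ℤ → A))
    (g : ℝ), IsSFT X → IsStronglyIrreducible X g → X ⊆ closure {x ∈ X | HasFiniteOrbit x}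

/-- **Gangloff–Sablik, Prop. 23** (§5.2 "Under some smaller threshold, the set of periodic points
is dense and the language is decidable"): let `X ⊆ A^{ℤ²}` be an `f`-block gluing `ℤ²`-SFT where
the gap function `f : ℕ → ℕ` (non-decreasing, standing assumption of §4.1.1) satisfies
`f(n) ∈ o(log n)` and `f ≤ id`. Then `X` has a dense set of periodic points
(`X ⊆ closure {x ∈ X | HasFiniteOrbit x}`; "periodic" = doubly periodic = finite orbit on `ℤ²`).
[cite: GangloffSablik2021, Prop. 23 (§5.2; arXiv:1706.01627 numbering)] -/
def GangloffSablik2021_densePeriodic : Prop :=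
  ∀ (A : Type) [Fintype A] [TopologicalSpace A] [DiscreteTopology A] (X : Set (ℤ × ℤ → A))
    (f : ℕ → ℕ), Monotone f → (∀ n, f n ≤ n) →
    ((fun n : ℕ => (f n : ℝ)) =o[atTop] fun n : ℕ => Real.log n) →
    IsSFT X → IsBlockGluing X f → X ⊆ closure {x ∈ X | HasFiniteOrbit x}

/-- **Gangloff–Sablik, Thm. 26** (§5.4 "Existence of aperiodic linearly block gluing subshifts";
announced in the introduction as: "there exists some `f ∈ O(n)` such that there exists an
aperiodic `f`-block gluing SFT"): there is a non-empty `ℤ²`-subshift of finite type over a finite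
alphabet which is aperiodic (`IsAperiodic`: no configuration has a non-zero period, their Def. 4)
and linearly block gluing (`IsLinearlyBlockGluing`: `f`-block gluing for some `f` with
`f n ≤ C n`). Non-emptiness is implicit in the source (the example is built on Robinson's
subshift, non-empty by their Thm. 5). [cite: GangloffSablik2021, Thm. 26 (§5.4; arXiv:1706.01627 numbering)] -/
def GangloffSablik2021_aperiodic : Prop :=
  ∃ (k : ℕ) (X : Set (ℤ × ℤ → Fin k)),
    X.Nonempty ∧ IsSFT X ∧ IsAperiodic X ∧ IsLinearlyBlockGluing X

/-- **Hochman 2025, Thm. 1.1**: "For every `d ≥ 2`, there exist strongly irreducible `ℤ^d`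
subshifts without periodic points." Formally: for every `d ≥ 2` there are a finite alphabet
`Fin k`, a non-empty subshift `X ⊆ (Fin k)^{ℤ^d}` (closed and shift-invariant, `IsSubshift`, with
`ℤ^d = Fin d → ℤ`) and a gap `g ≥ 0` such that `X` is strongly irreducible with gap `g`
(`IsStronglyIrreducible`, sup-metric) and no configuration of `X` has a finite orbit ("periodic
point means a point with finite orbit under the shift action", §1.1). The proof is for `d = 2`
(gap `10`, "a very large alphabet"), the general case by taking subshifts whose 2-dimensional
slices lie in the example. [cite: Hochman2025, Thm. 1.1] -/
def Hochman2025_existsSIAperiodic : Prop :=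
  ∀ d : ℕ, 2 ≤ d → ∃ (k : ℕ) (X : Set ((Fin d → ℤ) → Fin k)) (g : ℝ),
    0 ≤ g ∧ X.Nonempty ∧ IsSubshift X ∧ IsStronglyIrreducible X g ∧ ∀ x ∈ X, ¬ HasFiniteOrbit x

/-- Lightwood's theorem in the finite-set form of strong irreducibility used by route
PneNP/AperiodicTorus: an SFT (closed, finite alphabet) that is strongly irreducible along finite
sets is strongly irreducible along all sets (`IsFinitelyStronglyIrreducible.isStronglyIrreducible`),
so the fact applies. [cite: Lightwood2003, main theorem on periodic points; restated in CeccheriniSilbersteinCoornaert2012 §1] -/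
theorem Lightwood2003_densePeriodic.of_isFinitelyStronglyIrreducible
    (h : Lightwood2003_densePeriodic) {A : Type} [Fintype A] [TopologicalSpace A]
    [DiscreteTopology A] {X : Set (ℤ × ℤ → A)} {g : ℝ} (hSFT : IsSFT X)
    (hSI : IsFinitelyStronglyIrreducible X g) : X ⊆ closure {x ∈ X | HasFiniteOrbit x} :=
  h A X g hSFT (hSI.isStronglyIrreducible hSFT.isSubshift.1)

/-- Consequence used by the route's triage (crux #5 "why it might fail"): under Lightwood's
theorem, a NON-EMPTY aperiodic `ℤ²`-SFT (e.g. the tiling space of an aperiodic Wang tile set) is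
never strongly irreducible along finite sets, for any gap. [folklore] -/
theorem Lightwood2003_densePeriodic.not_isFinitelyStronglyIrreducible_of_isAperiodic
    (h : Lightwood2003_densePeriodic) {A : Type} [Fintype A] [TopologicalSpace A]
    [DiscreteTopology A] {X : Set (ℤ × ℤ → A)} (hSFT : IsSFT X) (hne : X.Nonempty)
    (hap : IsAperiodic X) (g : ℝ) : ¬ IsFinitelyStronglyIrreducible X g := by
  intro hSI
  have hdense := h.of_isFinitelyStronglyIrreducible hSFT hSI
  -- an aperiodic set has no periodic configuration, so the closure above is empty
  have hempty : {x ∈ X | HasFiniteOrbit x} = ∅ := by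
    ext x
    simp only [mem_sep_iff, mem_empty_iff_false, iff_false, not_and]
    intro hx hfin
    obtain ⟨m, n, hm, -, hmx, -⟩ := (hasFiniteOrbit_iff_exists_shift_eq x).mp hfin
    exact hap x hx ((m : ℤ), 0) (by simp [Prod.ext_iff, hm.ne']) hmx
  rw [hempty, closure_empty] at hdense
  obtain ⟨x, hx⟩ := hne
  exact hdense hx

end Literature.Dynamics.SymbolicDynamics
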